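import Mathlib
import HarnessLib
import Summits.HubbardSuperconductivity.HubbardSuperconductivity.Theorems.KLProgrammeKLRegimeSplitTwoLegSizesMSChainSizes
import Summits.HubbardSuperconductivity.HubbardSuperconductivity.Theorems.KLProgrammeKLRegimeSplitTwoLegSizesMSPieceParts
import Summits.HubbardSuperconductivity.HubbardSuperconductivity.Theorems.KLProgrammePerturbedFermiCurveTowerOfSizes

/-!
# Route `KLProgramme`, crux K3 — gen-5 ENGINE child (stmt-…-19918, `stub_twoLeg_step`, clause `TwoLegSizesMST`), recipe (L)+(F):
# THE CHAIN FRAMES' FERMI CURVES ARE `C⁴` WITH k3c3-p3's SIZE-KEYED TOWERS ((P4-c), step 3)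

Seat hubbard-kl-k3c3-p1 (g3).  From per-piece sizes `‖Dʲ evalM (Kp m)‖ ≤ a m j` (`m ≤ N`, `j ≤ 4`), ONE `C²` budget `A` dominating the chain sums
of `…TwoLegSizesMSChainSizes` (coarse pieces + constant + `3·anchorSize` for low parts + `4·anchorSize` for high parts, `j ≤ 2`), `A ≤ 1/20`, the
transversality room `klCurveD ≤ Dt_min − 2A`, the window margins at the level `μ`, and third/fourth-order budgets `A₃, A₄` dominating the
corresponding chain sums: every chain frame `msChain d Kp n N k` (`k ≤ N − n`) has a `C⁴` Fermi-point map with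
`‖Dⁱγ‖ ≤ klCurveD1, klCurveD2, klCurveD3 A₃, klCurveD4 A₃ A₄` (P2-INTERFACE §1 `fermiPointLp_sizes_of_sizes`), and `klFermiPoint μ (msChain …)` is `C⁴`
as a map into `Fin 2 → ℝ` (the `hC` input of `twoLegSizesMST_succ_of_chain_sizes`).  Proofs only; nothing about the model.
-/

noncomputable section

namespace Summit.HubbardSuperconductivity.HubbardSuperconductivity.Theorems.KLRegimeSplit

set_option linter.dupNamespace false -- summit = problem name (single-conjunct summit), D-0017

open Real Finset Literature.MathematicalPhysics.QuantumLattice Literature.MathematicalPhysics.QuantumLattice.BandSectorCounting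
open Summit.HubbardSuperconductivity.HubbardSuperconductivity.Theorems.DispersionFlow
open Summit.HubbardSuperconductivity.HubbardSuperconductivity.Theorems.PerturbedFermiCurve

/-- A curve that is `Cⁿ` into `EuclideanSpace` is `Cⁿ` into `Fin 2 → ℝ`. -/
theorem contDiff_of_contDiff_toLp {n : WithTop ℕ∞} {f : ℝ → Fin 2 → ℝ}
    (h : ContDiff ℝ n (fun θ => (WithLp.toLp 2 (f θ) : EuclideanSpace ℝ (Fin 2)))) : ContDiff ℝ n f := by
  have e : f = (fun x : EuclideanSpace ℝ (Fin 2) => (WithLp.ofLp x : Fin 2 → ℝ)) ∘ fun θ => (WithLp.toLp 2 (f θ) : EuclideanSpace ℝ (Fin 2)) := by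
    funext θ; simp
  rw [e]
  exact (PiLp.contDiff_ofLp (p := 2)).comp h

section Chain

variable (d : ℕ) {Kp : ℕ → TrigPolyC4v} {n N : ℕ} (hnN : n ≤ N) {a : ℕ → ℕ → ℝ}
  (ha : ∀ m ≤ N, ∀ j ≤ 4, ∀ q : Momentum, ‖iteratedFDeriv ℝ j (evalM (Kp m)) q‖ ≤ a m j)

/-- The per-order size SUM of the chain (all high parts up to the deepest slot): coarse pieces + constant + low parts (contraction form) +
high parts (contraction form). -/
def chainSizeSum (Kp : ℕ → TrigPolyC4v) (a : ℕ → ℕ → ℝ) (n N j : ℕ) : ℝ :=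
  ∑ m ∈ range (n + 1), a m j + (if j = 0 then |∑ m ∈ Ioc n N, (Kp m).eval 0| else 0) +
    ∑ m ∈ Ioc n N, 3 * anchorSize (a m) j + ∑ m ∈ Ioc n N, 4 * anchorSize (a m) j

include hnN ha in
/-- **Every chain frame's `frameShift` is bounded by the chain size sum** (`j ≤ 4`, every `k ≤ N − n`). -/
theorem norm_iteratedFDeriv_frameShift_msChain_le_sum {k : ℕ} (hk : k ≤ N - n) {j : ℕ} (hj : j ≤ 4) (q : Momentum) :
    ‖iteratedFDeriv ℝ j (frameShift (msChain d Kp n N k)) q‖ ≤ chainSizeSum Kp a n N j := by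
  have h := norm_iteratedFDeriv_frameShift_msChain_le d Kp hnN k j q
  have h1 : ∑ m ∈ range (n + 1), ‖iteratedFDeriv ℝ j (evalM (Kp m)) q‖ ≤ ∑ m ∈ range (n + 1), a m j :=
    Finset.sum_le_sum fun m hm => ha m (by have := mem_range.mp hm; omega) j hj q
  have h2 : ∑ m ∈ Ioc n N, ‖iteratedFDeriv ℝ j (evalM (lowPart d (Kp m))) q‖ ≤ ∑ m ∈ Ioc n N, 3 * anchorSize (a m) j :=
    Finset.sum_le_sum fun m hm => norm_iteratedFDeriv_evalM_lowPart_le d (ha m (Finset.mem_Ioc.mp hm).2) hj q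
  have h3 : ∑ m ∈ Ioc n (n + k), ‖iteratedFDeriv ℝ j (evalM (highPart d (Kp m))) q‖ ≤ ∑ m ∈ Ioc n N, 4 * anchorSize (a m) j := by
    have hsub : Ioc n (n + k) ⊆ Ioc n N := by
      intro m hm; rw [Finset.mem_Ioc] at hm ⊢; omega
    calc ∑ m ∈ Ioc n (n + k), ‖iteratedFDeriv ℝ j (evalM (highPart d (Kp m))) q‖
        ≤ ∑ m ∈ Ioc n N, ‖iteratedFDeriv ℝ j (evalM (highPart d (Kp m))) q‖ :=
          Finset.sum_le_sum_of_subset_of_nonneg hsub fun m _ _ => norm_nonneg _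
      _ ≤ ∑ m ∈ Ioc n N, 4 * anchorSize (a m) j :=
          Finset.sum_le_sum fun m hm => (norm_iteratedFDeriv_evalM_highPart_le d (ha m (Finset.mem_Ioc.mp hm).2)).1 j hj q
  unfold chainSizeSum
  linarith

include hnN ha in
/-- **THE CHAIN FRAMES' CURVES, size-keyed (P2-INTERFACE §1).**  With `A ≥ chainSizeSum … j` for `j ≤ 2`, `A ≤ 1/20`,
`klCurveD ≤ Dt_min − 2A`, margins `−1.1 ≤ μ − A`, `μ + A ≤ −0.1`, `A₃ ≥ chainSizeSum … 3`, `A₄ ≥ chainSizeSum … 4`: for every `k ≤ N − n` the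
Fermi-point map of `msChain d Kp n N k` at level `μ` is `C⁴` (both into `Momentum` and into `Fin 2 → ℝ`) with the tower
`klCurveD1, klCurveD2, klCurveD3 A₃, klCurveD4 A₃ A₄`. -/
theorem chain_curve_sizes {A : ℝ} (hA : ∀ j ≤ 2, chainSizeSum Kp a n N j ≤ A) (hA20 : A ≤ 1 / 20)
    (hd : klCurveD ≤ (bandBounds (show (-4 : ℝ) < -1.1 by norm_num) (show (-1.1 : ℝ) ≤ -0.1 by norm_num)
      (show (-0.1 : ℝ) < 0 by norm_num)).Dtmin - 2 * A)
    {μ : ℝ} (hlo : (-1.1 : ℝ) ≤ μ - A) (hhi : μ + A ≤ -0.1)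
    {A₃ A₄ : ℝ} (hA₃ : chainSizeSum Kp a n N 3 ≤ A₃) (hA₄ : chainSizeSum Kp a n N 4 ≤ A₄) {k : ℕ} (hk : k ≤ N - n) (θ : ℝ) :
    ContDiff ℝ 4 (fun θ : ℝ => (WithLp.toLp 2 (klFermiPoint μ (msChain d Kp n N k) θ) : Momentum)) ∧
    ContDiff ℝ 4 (klFermiPoint μ (msChain d Kp n N k)) ∧
    ‖iteratedFDeriv ℝ 1 (fun θ : ℝ => (WithLp.toLp 2 (klFermiPoint μ (msChain d Kp n N k) θ) : Momentum)) θ‖ ≤ klCurveD1 ∧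
    ‖iteratedFDeriv ℝ 2 (fun θ : ℝ => (WithLp.toLp 2 (klFermiPoint μ (msChain d Kp n N k) θ) : Momentum)) θ‖ ≤ klCurveD2 ∧
    ‖iteratedFDeriv ℝ 3 (fun θ : ℝ => (WithLp.toLp 2 (klFermiPoint μ (msChain d Kp n N k) θ) : Momentum)) θ‖ ≤ klCurveD3 A₃ ∧
    ‖iteratedFDeriv ℝ 4 (fun θ : ℝ => (WithLp.toLp 2 (klFermiPoint μ (msChain d Kp n N k) θ) : Momentum)) θ‖ ≤ klCurveD4 A₃ A₄ := by
  have hAj : ∀ p : Momentum, ∀ j ≤ 2, ‖iteratedFDeriv ℝ j (frameShift (msChain d Kp n N k)) p‖ ≤ A := fun p j hj =>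
    (norm_iteratedFDeriv_frameShift_msChain_le_sum d hnN ha hk (by omega) p).trans (hA j hj)
  have h3 : ∀ p : Momentum, ‖iteratedFDeriv ℝ 3 (frameShift (msChain d Kp n N k)) p‖ ≤ A₃ := fun p =>
    (norm_iteratedFDeriv_frameShift_msChain_le_sum d hnN ha hk (by norm_num) p).trans hA₃
  have h4 : ∀ p : Momentum, ‖iteratedFDeriv ℝ 4 (frameShift (msChain d Kp n N k)) p‖ ≤ A₄ := fun p =>
    (norm_iteratedFDeriv_frameShift_msChain_le_sum d hnN ha hk (by norm_num) p).trans hA₄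
  obtain ⟨hC, hD1, hD2, hD3, hD4⟩ := fermiPointLp_sizes_of_sizes hAj hA20 hd hlo hhi h3 h4 θ
  exact ⟨hC, contDiff_of_contDiff_toLp hC, hD1, hD2, hD3, hD4⟩

end Chain

end Summit.HubbardSuperconductivity.HubbardSuperconductivity.Theorems.KLRegimeSplit

end
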